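import Summits.QuantumFields.YangMills.Theorems.UnitScaleTiltProp7AvgTrueLinearisation
import Summits.QuantumFields.YangMills.Theorems.UnitScaleTiltProp7TrueLinDefectBound
import HarnessLib

/-!
# Route `UnitScaleTilt`, crux K1 «MinimiserStabilityRegPr» (stmt-QuantumFields-19200), lane α-P (EX growth side, NORMAL_W ∕ the JOINT ROW) — N3a:
# THE PER-LEVEL ℓ¹ TWO-POINT REMAINDER OF THE (0.4)-AVERAGE IS BOUNDED BY THE `ℓ²`-MASS, `Σ_c‖Ū(c)Ū₀(c)^* − 1 − T(U₀)[Y](c)‖ ≤ 260·((d+2)L)²·(2dL^d)·(2d)·Σ_b‖Y(b)‖²`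

Cell `ym3-torus`, keyed width hand `ym-routeR-w1` gen 2 (D-0154 (3c); brick (n3) of ★w4-19200 g4's NORMAL_W plan, «(n3) IS YOURS» 2026-08-28 12:41:57Z; his located reshaping:
the door reads ONE JOINT ROW per competitor direction, and the remainder `r` enters through the multiplier pairing `|⟨λ, r⟩| ≤ ‖λ‖_∞·‖r‖₁`).  THEOREMS ONLY (0 `def`, 0 `sorry`);
`--supports stmt-QuantumFields-19200`, count-neutral.  YM₃ on T³ is a ladder rung (R3), not the Clay problem; nothing here claims the stub, the crux, d = 4 or the mass gap.

THE POINT.  ★p1 g4's one-step row ✓ `Prop7HolRatioPerStep.norm_avgFun_ratio_sub_one_sub_trueLin_le` bounds the two-point remainder of ONE averaging step at a coarse bond `c`,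
`‖Ū(c)Ū₀(c)^* − 1 − T(U₀)[Y](c)‖ ≤ 260·m²`, by the WORD-MASS `m` (the `ℓ¹` mass of `Y = UU₀^* − 1` along the (0.4) loop words and the straight segment at `c`).  Word masses
are at most `(d+2)L·S(c)`, `S(c) = Σ_{b∈N(c)}‖Y(b)‖` the two-block neighbourhood mass (★routeR-w3 g0's ✓ `mass_loop_le`∕`mass_segment_le`), `S(c)² ≤ 2dL^d·Σ_{N(c)}‖Y‖²`
(Cauchy–Schwarz, `|N(c)| ≤ 2dL^d`) and every fine bond lies in at most `2d` neighbourhoods (✓ `sum_nbhd_le`).  Hence the ℓ¹ two-point row of ONE level in `ℓ²`-MASS currency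
with an L-ONLY constant — no `sup² × volume`, no mean-value∕regularity input: the remainder is a quadratic form over pairs of bonds on common words, and this is its Schur bound.
It is the level-`j` brick of `‖r‖₁` (the remainder of the `k`-fold average on the fibre) — the tower sum (N3b) pushes these through the pure-line family; for smooth directions
★routeR-w3 g2's masses `Σ_b‖Y_j b‖² ≲ ρ^{2j}Σ‖Y‖²` (`ρ² = L⁻¹`) then give the `ℓ⁻¹` gain, for concentrated directions the constant is absolute — the two regimes of ★w4 g4's count.

WHAT IS PROVED (ns `…Theorems.Prop7FibreRemainderL1Level`; any `Params`, `SU(n)`, level `j + 1 ≤ m + K`).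
* §1 `nbhdMass_sq_le` (`S(c)² ≤ 2dL^d·Σ_{N(c)}‖Y‖²`).
* §2 ★ `norm_ratio_sub_trueLin_le_nbhdMass` — per coarse bond, `≤ 260·((d+2)L·S(c))²`, under the (0.4) loop guard `α ≤ 1∕24` at `c` and the sup `‖Y(b)‖ ≤ s` with
  `72·((d+2)L·(2dL^d·s)) ≤ 1`, `3·((d+2)L·(2dL^d·s)) + α < δ_N` (the one-step row's windows at the crude word-mass bound).
* §3 ★★ `sum_norm_ratio_sub_trueLin_le_mass` — the title row.
HONEST SCOPE.  One level; the remainder text is the one-step row's VERBATIM (extracted from the tree file); nothing of Bałaban's analysis is asserted; the joint row itself is NOT here.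

References: T. Bałaban, CMP 98 (1985) 17–51 [Balaban1985Averaging] (Prop. 3 (122)–(126) p.36); CMP 109 (1987) 249–301 [Balaban1987RG1] ((0.4) p.253);
CMP 102 (1985) 277–309 [Balaban1985Variational] ((47)–(48) p.285, (141)–(142) p.299).
-/

set_option autoImplicit false

noncomputable section

open scoped BigOperators Matrix.Norms.L2Operator

namespace Summit.QuantumFields.YangMills.Theorems.Prop7FibreRemainderL1Level

open Literature.MathematicalPhysics.QuantumFieldTheory.Balaban1983to89
open Finset T4Continuum BlockAveraging AveragingRT ExpMeanLog BlockAveragingEMLLinearised BlockAveragingEMLLinearisedBackground BlockAveragingEMLProp2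
open Summit.QuantumFields.YangMills.Theorems.Prop7HolRatioPerStep (norm_avgFun_ratio_sub_one_sub_trueLin_le)
open Summit.QuantumFields.YangMills.Theorems.Prop7TrueLinDefectBound (mass_loop_le mass_segment_le card_nbhd_le sum_nbhd_le)

variable {P : Params} {n : Type*} [Fintype n] [DecidableEq n] [Nonempty n] {j : ℕ}

/-! ## §1 The neighbourhood mass `S(c) = Σ_{b∈N(c)}‖Y(b)‖`: square against the `ℓ²` mass, and the word masses against `S(c)` -/

omit [Nonempty n] in
/-- `S(c)² ≤ (2dL^d)·Σ_{b∈N(c)}‖Y(b)‖²` (Cauchy–Schwarz on `|N(c)| ≤ 2dL^d`). [folklore] -/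
theorem nbhdMass_sq_le (hj : j + 1 ≤ P.m + P.K) (Y : PBond P j → Matrix n n ℂ) (c : PBond P (j + 1)) :
    (∑ b ∈ (univ.filter (fun b : PBond P j => blockOf b.src = c.src ∨ blockOf b.src = c.tgt)), ‖Y b‖) ^ 2 ≤ (2 * P.d * (P.L : ℝ) ^ P.d) * ∑ b ∈ (univ.filter (fun b : PBond P j => blockOf b.src = c.src ∨ blockOf b.src = c.tgt)), ‖Y b‖ ^ 2 := by
  have hcs := Finset.sum_mul_sq_le_sq_mul_sq (univ.filter (fun b : PBond P j => blockOf b.src = c.src ∨ blockOf b.src = c.tgt)) (fun b => ‖Y b‖) (fun _ => (1 : ℝ))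
  simp only [mul_one, one_pow, Finset.sum_const, nsmul_eq_mul, mul_one] at hcs
  calc (∑ b ∈ (univ.filter (fun b : PBond P j => blockOf b.src = c.src ∨ blockOf b.src = c.tgt)), ‖Y b‖) ^ 2
      ≤ (∑ b ∈ (univ.filter (fun b : PBond P j => blockOf b.src = c.src ∨ blockOf b.src = c.tgt)), ‖Y b‖ ^ 2) * (((univ.filter (fun b : PBond P j => blockOf b.src = c.src ∨ blockOf b.src = c.tgt)).card : ℕ) : ℝ) := hcs
    _ ≤ (∑ b ∈ (univ.filter (fun b : PBond P j => blockOf b.src = c.src ∨ blockOf b.src = c.tgt)), ‖Y b‖ ^ 2) * (2 * P.d * (P.L : ℝ) ^ P.d) :=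
        mul_le_mul_of_nonneg_left (card_nbhd_le (P := P) hj c) (Finset.sum_nonneg fun _ _ => sq_nonneg _)
    _ = _ := by ring

/-! ## §2 ★ The per-level two-point remainder, bond by bond, in neighbourhood-mass currency -/

/-- ★ **PER COARSE BOND**: at a level-`j` pair `(U₀, U)` with the (0.4) loop variables of `U₀` within `α ≤ 1∕24` of `1` and the sup `‖Y(b)‖ ≤ s` (`Y = UU₀^* − 1`) so small that
`72·((d+2)L·(2dL^d·s)) ≤ 1` and `3·((d+2)L·(2dL^d·s)) + α < δ_N`: the two-point remainder of the one-step average at `c` is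
`‖Ū(c)Ū₀(c)^* − 1 − T(U₀)[Y](c)‖ ≤ 260·((d+2)L)²·S(c)²`, `S(c) = Σ_{b∈N(c)}‖Y(b)‖` — ✓ `norm_avgFun_ratio_sub_one_sub_trueLin_le` at the word-mass `m := (d+2)L·S(c)`
(✓ `mass_loop_le`, ✓ `mass_segment_le`). [cite: Balaban1985Averaging, Prop. 3 (122)-(126) p.36; Balaban1987RG1, (0.4) p.253] -/
theorem norm_ratio_sub_trueLin_le_nbhdMass (hj : j + 1 ≤ P.m + P.K) (U₀ U : GaugeField P j (Matrix.specialUnitaryGroup n ℂ)) (c : PBond P (j + 1))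
    {α s : ℝ} (hα : ∀ i : Idx P, dist1 (loopHol U₀ c i) ≤ α) (hα24 : α ≤ 1 / 24)
    (hs0 : 0 ≤ s) (hs : ∀ b : PBond P j, ‖pertVar U₀ U b‖ ≤ s)
    (h72 : 72 * ((((P.d + 2) * P.L : ℕ) : ℝ) * ((2 * P.d * (P.L : ℝ) ^ P.d) * s)) ≤ 1)
    (hN : 3 * ((((P.d + 2) * P.L : ℕ) : ℝ) * ((2 * P.d * (P.L : ℝ) ^ P.d) * s)) + α < deltaSU n) :
    ‖((avgFun (expMeanLogSU (n := n)) U c : Matrix.specialUnitaryGroup n ℂ) : Matrix n n ℂ) *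
          star ((avgFun (expMeanLogSU (n := n)) U₀ c : Matrix.specialUnitaryGroup n ℂ) : Matrix n n ℂ) - 1 -
        (fderiv ℂ (eml : (Idx P → Matrix n n ℂ) → Matrix n n ℂ) (fun i => ((loopHol U₀ c i : Matrix.specialUnitaryGroup n ℂ) : Matrix n n ℂ))
            (fun i => covWalkSum U₀ (pertVar U₀ U) (walk (emb c.src) (loopWord P.L c.dir (off i.1) i.2.1 i.2.2))
              * ((loopHol U₀ c i : Matrix.specialUnitaryGroup n ℂ) : Matrix n n ℂ))
            * star ((corr (expMeanLogSU (n := n)) U₀ c : Matrix.specialUnitaryGroup n ℂ) : Matrix n n ℂ)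
          + ((corr (expMeanLogSU (n := n)) U₀ c : Matrix.specialUnitaryGroup n ℂ) : Matrix n n ℂ)
            * covWalkSum U₀ (pertVar U₀ U) (walk (emb c.src) (List.replicate P.L (c.dir, true)))
            * star ((corr (expMeanLogSU (n := n)) U₀ c : Matrix.specialUnitaryGroup n ℂ) : Matrix n n ℂ))‖
      ≤ 260 * (((((P.d + 2) * P.L : ℕ) : ℝ)) * ∑ b ∈ (univ.filter (fun b : PBond P j => blockOf b.src = c.src ∨ blockOf b.src = c.tgt)), ‖pertVar U₀ U b‖) ^ 2 := by
  -- the neighbourhood mass and its size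
  have hS0 : 0 ≤ ∑ b ∈ (univ.filter (fun b : PBond P j => blockOf b.src = c.src ∨ blockOf b.src = c.tgt)), ‖pertVar U₀ U b‖ := Finset.sum_nonneg fun _ _ => norm_nonneg _
  have hSle : ∑ b ∈ (univ.filter (fun b : PBond P j => blockOf b.src = c.src ∨ blockOf b.src = c.tgt)), ‖pertVar U₀ U b‖ ≤ (2 * P.d * (P.L : ℝ) ^ P.d) * s := by
    calc ∑ b ∈ (univ.filter (fun b : PBond P j => blockOf b.src = c.src ∨ blockOf b.src = c.tgt)), ‖pertVar U₀ U b‖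
        ≤ ∑ b ∈ (univ.filter (fun b : PBond P j => blockOf b.src = c.src ∨ blockOf b.src = c.tgt)), s := Finset.sum_le_sum fun b _ => hs b
      _ = (((univ.filter (fun b : PBond P j => blockOf b.src = c.src ∨ blockOf b.src = c.tgt)).card : ℕ) : ℝ) * s := by rw [Finset.sum_const, nsmul_eq_mul]
      _ ≤ (2 * P.d * (P.L : ℝ) ^ P.d) * s := mul_le_mul_of_nonneg_right (card_nbhd_le (P := P) hj c) hs0
  have hcast0 : (0 : ℝ) ≤ (((P.d + 2) * P.L : ℕ) : ℝ) := Nat.cast_nonneg _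
  have hm_le : (((P.d + 2) * P.L : ℕ) : ℝ) * ∑ b ∈ (univ.filter (fun b : PBond P j => blockOf b.src = c.src ∨ blockOf b.src = c.tgt)), ‖pertVar U₀ U b‖ ≤ (((P.d + 2) * P.L : ℕ) : ℝ) * ((2 * P.d * (P.L : ℝ) ^ P.d) * s) :=
    mul_le_mul_of_nonneg_left hSle hcast0
  exact norm_avgFun_ratio_sub_one_sub_trueLin_le U₀ U c (fun i => mass_loop_le hj (pertVar U₀ U) c i) (mass_segment_le hj (pertVar U₀ U) c)
    (by linarith) hα hα24 (by linarith)

/-! ## §3 ★★ The per-level ℓ¹ two-point row in `ℓ²`-MASS currency (L-only constant, no volume, no regularity row) -/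

/-- ★★ **N3a — THE PER-LEVEL ℓ¹ TWO-POINT REMAINDER OF THE (0.4)-AVERAGE IS BOUNDED BY THE `ℓ²`-MASS**: under the hypotheses of §2 at EVERY coarse bond,
`Σ_c ‖Ū(c)Ū₀(c)^* − 1 − T(U₀)[Y](c)‖ ≤ 260·((d+2)L)²·(2dL^d)·(2d)·Σ_b‖Y(b)‖²` — per bond `260·m_c²` (§2), `S(c)² ≤ 2dL^d·Σ_{N(c)}‖Y‖²` (§1), multiplicity
`≤ 2d` (✓ `sum_nbhd_le`).  An L-ONLY constant: no `sup² × volume`, no mean-value∕regularity input — the quadratic form over bond pairs on common words, summed by Schur.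
This is the level-`j` brick of the ℓ¹ remainder `‖r‖₁` in the α-P lane's JOINT ROW (★w4-19200 g4, 2026-08-28 12:41Z). [cite: Balaban1985Averaging, Prop. 3 (122)-(126) p.36; Balaban1987RG1, (0.4) p.253] -/
theorem sum_norm_ratio_sub_trueLin_le_mass (hj : j + 1 ≤ P.m + P.K) (U₀ U : GaugeField P j (Matrix.specialUnitaryGroup n ℂ))
    {α s : ℝ} (hα : ∀ (c : PBond P (j + 1)) (i : Idx P), dist1 (loopHol U₀ c i) ≤ α) (hα24 : α ≤ 1 / 24)
    (hs0 : 0 ≤ s) (hs : ∀ b : PBond P j, ‖pertVar U₀ U b‖ ≤ s)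
    (h72 : 72 * ((((P.d + 2) * P.L : ℕ) : ℝ) * ((2 * P.d * (P.L : ℝ) ^ P.d) * s)) ≤ 1)
    (hN : 3 * ((((P.d + 2) * P.L : ℕ) : ℝ) * ((2 * P.d * (P.L : ℝ) ^ P.d) * s)) + α < deltaSU n) :
    ∑ c : PBond P (j + 1), ‖((avgFun (expMeanLogSU (n := n)) U c : Matrix.specialUnitaryGroup n ℂ) : Matrix n n ℂ) *
          star ((avgFun (expMeanLogSU (n := n)) U₀ c : Matrix.specialUnitaryGroup n ℂ) : Matrix n n ℂ) - 1 -
        (fderiv ℂ (eml : (Idx P → Matrix n n ℂ) → Matrix n n ℂ) (fun i => ((loopHol U₀ c i : Matrix.specialUnitaryGroup n ℂ) : Matrix n n ℂ))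
            (fun i => covWalkSum U₀ (pertVar U₀ U) (walk (emb c.src) (loopWord P.L c.dir (off i.1) i.2.1 i.2.2))
              * ((loopHol U₀ c i : Matrix.specialUnitaryGroup n ℂ) : Matrix n n ℂ))
            * star ((corr (expMeanLogSU (n := n)) U₀ c : Matrix.specialUnitaryGroup n ℂ) : Matrix n n ℂ)
          + ((corr (expMeanLogSU (n := n)) U₀ c : Matrix.specialUnitaryGroup n ℂ) : Matrix n n ℂ)
            * covWalkSum U₀ (pertVar U₀ U) (walk (emb c.src) (List.replicate P.L (c.dir, true)))
            * star ((corr (expMeanLogSU (n := n)) U₀ c : Matrix.specialUnitaryGroup n ℂ) : Matrix n n ℂ))‖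
      ≤ 260 * ((((P.d + 2) * P.L : ℕ) : ℝ)) ^ 2 * (2 * P.d * (P.L : ℝ) ^ P.d) * (2 * P.d) * ∑ b : PBond P j, ‖pertVar U₀ U b‖ ^ 2 := by
  have hK0 : (0 : ℝ) ≤ 260 * ((((P.d + 2) * P.L : ℕ) : ℝ)) ^ 2 * (2 * P.d * (P.L : ℝ) ^ P.d) := by positivity
  calc ∑ c : PBond P (j + 1), ‖((avgFun (expMeanLogSU (n := n)) U c : Matrix.specialUnitaryGroup n ℂ) : Matrix n n ℂ) *
          star ((avgFun (expMeanLogSU (n := n)) U₀ c : Matrix.specialUnitaryGroup n ℂ) : Matrix n n ℂ) - 1 -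
        (fderiv ℂ (eml : (Idx P → Matrix n n ℂ) → Matrix n n ℂ) (fun i => ((loopHol U₀ c i : Matrix.specialUnitaryGroup n ℂ) : Matrix n n ℂ))
            (fun i => covWalkSum U₀ (pertVar U₀ U) (walk (emb c.src) (loopWord P.L c.dir (off i.1) i.2.1 i.2.2))
              * ((loopHol U₀ c i : Matrix.specialUnitaryGroup n ℂ) : Matrix n n ℂ))
            * star ((corr (expMeanLogSU (n := n)) U₀ c : Matrix.specialUnitaryGroup n ℂ) : Matrix n n ℂ)
          + ((corr (expMeanLogSU (n := n)) U₀ c : Matrix.specialUnitaryGroup n ℂ) : Matrix n n ℂ)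
            * covWalkSum U₀ (pertVar U₀ U) (walk (emb c.src) (List.replicate P.L (c.dir, true)))
            * star ((corr (expMeanLogSU (n := n)) U₀ c : Matrix.specialUnitaryGroup n ℂ) : Matrix n n ℂ))‖
      ≤ ∑ c : PBond P (j + 1), 260 * ((((P.d + 2) * P.L : ℕ) : ℝ)) ^ 2 * (2 * P.d * (P.L : ℝ) ^ P.d) * ∑ b ∈ (univ.filter (fun b : PBond P j => blockOf b.src = c.src ∨ blockOf b.src = c.tgt)), ‖pertVar U₀ U b‖ ^ 2 := by
        refine Finset.sum_le_sum fun c _ => ?_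
        refine (norm_ratio_sub_trueLin_le_nbhdMass hj U₀ U c (hα c) hα24 hs0 hs h72 hN).trans ?_
        have h1 := nbhdMass_sq_le hj (pertVar U₀ U) c
        have h2 : (0 : ℝ) ≤ 260 * ((((P.d + 2) * P.L : ℕ) : ℝ)) ^ 2 := by positivity
        calc 260 * (((((P.d + 2) * P.L : ℕ) : ℝ)) * ∑ b ∈ (univ.filter (fun b : PBond P j => blockOf b.src = c.src ∨ blockOf b.src = c.tgt)), ‖pertVar U₀ U b‖) ^ 2
            = 260 * ((((P.d + 2) * P.L : ℕ) : ℝ)) ^ 2 * (∑ b ∈ (univ.filter (fun b : PBond P j => blockOf b.src = c.src ∨ blockOf b.src = c.tgt)), ‖pertVar U₀ U b‖) ^ 2 := by ring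
          _ ≤ 260 * ((((P.d + 2) * P.L : ℕ) : ℝ)) ^ 2 * ((2 * P.d * (P.L : ℝ) ^ P.d) * ∑ b ∈ (univ.filter (fun b : PBond P j => blockOf b.src = c.src ∨ blockOf b.src = c.tgt)), ‖pertVar U₀ U b‖ ^ 2) :=
              mul_le_mul_of_nonneg_left h1 h2
          _ = _ := by ring
    _ = 260 * ((((P.d + 2) * P.L : ℕ) : ℝ)) ^ 2 * (2 * P.d * (P.L : ℝ) ^ P.d) *
          ∑ c : PBond P (j + 1), ∑ b ∈ (univ.filter (fun b : PBond P j => blockOf b.src = c.src ∨ blockOf b.src = c.tgt)), ‖pertVar U₀ U b‖ ^ 2 := by rw [Finset.mul_sum]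
    _ ≤ 260 * ((((P.d + 2) * P.L : ℕ) : ℝ)) ^ 2 * (2 * P.d * (P.L : ℝ) ^ P.d) * (2 * P.d * ∑ b : PBond P j, ‖pertVar U₀ U b‖ ^ 2) :=
        mul_le_mul_of_nonneg_left (sum_nbhd_le (P := P) (fun b => ‖pertVar U₀ U b‖ ^ 2) fun _ => sq_nonneg _) hK0
    _ = _ := by ring

end Summit.QuantumFields.YangMills.Theorems.Prop7FibreRemainderL1Level

end
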